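import Literature.MathematicalPhysics.QuantumFieldTheory.Balaban1983to89.T3B8Thm2AtMembers
import Summits.QuantumFields.YangMills.Theorems.UnitScaleTiltProp7Thm2SocketOfCoverForm
import Summits.QuantumFields.YangMills.Theorems.UnitScaleTiltMinimiserStabilityRegPrOfB8Thm2AtT3Members
import HarnessLib

/-!
# Route `UnitScaleTilt`, crux K1 «MinimiserStabilityRegPr» (stmt-QuantumFields-19200) — THE NAMED FACT `B8Thm2AtT3Members`
# ([Balaban1985RegularSpaces] THEOREM 2 AT THE T³ MEMBERS) FOLLOWS FROM lit-balaban's TORUS COVER FORM AT BLOCK-SIZE INDEX `ℓ = 2` ALONE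

Fact-debt scoping hand `ym-fact-b8thm2-scope-1` (prover seat, 2026-08-31; director-ym R624-ym ∕ operator priority19).  THEOREMS ONLY (0 `def`,
0 `sorry`, standard axioms); `--supports stmt-QuantumFields-19200 --as helper`; registry ∕ route ∕ display untouched.

WHY.  The Literature named fact ✓`T3B8Thm2AtMembers.B8Thm2AtT3Members` (p793328) — [Balaban1985RegularSpaces] Thm 2 p. 83 at the `SU(2)` Setup-torus
objects of every member `(F, n < K)` of every T³ family — is, by kernel, equivalent to its block-size-`3` instance
(✓`MinimiserStabilityRegPrOfB8Thm2AtT3Members.b8Thm2AtT3Members_iff_hThm2S3`): every `L ≥ 5` is served by lit-balaban's binder-free torus cover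
form ✓`B8Thm2TorusCoverOfProp6DeltaA.hThm2Cover_of_prop6_deltaA (hℓ : 4 ≤ ℓ)` read in the socket currency by
✓`Prop7Thm2SocketOfCoverForm.thm2SetupSUAt_allMembers_of_coverForm`.  The port plan of record for the residue
(`run/shared/lean/pub/ym-fleet/ym-fact-b8thm2-scope-1/PORT-PLAN-B8Thm2-v1.md`) is an `ℓ = 2` RE-EDITION of that cover form inside cell
lit-balaban's cone (carrier field `B6KLevelCensusIndexV1.KIdx.hℓ : 4 ≤ ℓ`; [Balaban1985BackgroundPropagators] Cor. 3.6 cut-off window).  THIS FILE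
fixes, BY KERNEL, what that re-edition has to deliver and nothing more: §1 proves that the socket's DESCENT (numeric windows by
✓`B8Thm2TorusCoverGCOfProp6.exists_admissible_sizes_below`, cover period → member period through the uniqueness half
✓`BalabanUVNodesN16Thm2TorusOfCover.thm2TorusAt_of_dvd'`, torus → Setup currency ✓`B8Thm2SetupTorus.thm2SetupSUAt_of_thm2TorusAt`) carries NO floor on
the block size beyond `L > 1` — it is the proof of `thm2SetupSUAt_allMembers_of_coverForm` with the cover form taken as a HYPOTHESIS at an arbitrary index
`ℓ`; §2 specialises to `ℓ = 2` and composes with `b8Thm2AtT3Members_of_hThm2S3`.  So `B8Thm2AtT3Members_holds` ⟸ «the text of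
`hThm2Cover_of_prop6_deltaA` with `4 ≤ ℓ` replaced by `ℓ = 2`», VERBATIM, and the only `ℓ ≥ 4` input of the `L ≥ 5` theorem is the cover form itself.

WHAT THIS FILE PROVES.
* §1 ★ `thm2SetupSUAt_allMembers_of_coverFormAt` — for ANY `ℓ` with `ℓ + 1` odd `> 1`: the cover-form text at `ℓ` (hypothesis `hCover`, the type of
  `hThm2Cover_of_prop6_deltaA hℓ` with its binder telescope `τ hτ hτt hCτ hM1 hαE0 hα1 len`) ⟹ the socket body at `L = ℓ + 1`
  (`∃ B₁ c₁ > 0, ∀ F, F.L = ℓ + 1 → ∀ n < K, ∃ β₀ B₂ len, Thm2SetupSUAt (F.P K) 2 (K − n) (eta F n K) β₀ B₁ B₂ c₁ len ⊤`).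
* §2 ★★ `b8Thm2AtT3Members_of_coverForm_two` — the cover-form text at `ℓ = 2` ⟹ `B8Thm2AtT3Members`.
Consistency check (performed in scratch, farm rc 0, not re-landed because it restates p782708's §2 by `dedup.landed`): §1 at `4 ≤ ℓ` fed with
`fun τ hτ hτt Cτ hCτ M hM1 α hαE0 hα1 len => hThm2Cover_of_prop6_deltaA hℓ τ hτ hτt hCτ hM1 hαE0 hα1` (instances on `(geo9K i).Site` by `inferInstance`
after unfolding) re-proves `Prop7Thm2SocketOfCoverForm.thm2SetupSUAt_allMembers_of_coverForm` verbatim.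

HONEST SCOPE.  Plumbing over landed theorems by name; CONDITIONAL on the `ℓ = 2` cover form, which NOTHING in the tree proves (lit-balaban's chain
carries `KIdx.hℓ : 4 ≤ ℓ`); `B8Thm2AtT3Members`, `hThm2S`, EX, the crux 19200 and R3 are NOT proved here; rung R3 = SU(2) YM₃ on T³ — NOT d = 4, NOT
infinite volume, NOT a mass gap, NOT Clay; the Yang–Mills mass gap is NOT proved.
References: T. Bałaban, CMP **99** (1985) 75–102 [Balaban1985RegularSpaces] (Thm 2 p.83, (1.33)–(1.39) pp.82–83, Prop. 6 p.99, p.77 «Ω_j = T_η»,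
«M₁ … depends on d and L only»); CMP **99** (1985) 389–434 [Balaban1985BackgroundPropagators] (Thm 3.3 p.399, Thm 3.10 pp.414–416, Cor. 3.6 p.408);
CMP **98** (1985) 17–51 [Balaban1985Averaging] ((20) p.21); CMP **102** (1985) 255–275 [Balaban1985UV3] ((1)–(3) p.256).
-/

set_option autoImplicit false

noncomputable section

open scoped BigOperators Matrix Matrix.Norms.L2Operator

namespace Summit.QuantumFields.YangMills.Theorems.B8Thm2AtT3MembersOfCoverFormTwo

open Literature.MathematicalPhysics.QuantumFieldTheory.Balaban1983to89
open B7Prop1Explicit renaming Site → LSite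
open B6GlobalChartV1 (PV)
open B9Eq316AveragingTransposeZd (betaTau alphaQ)
open B7Prop2Explicit (C0 c2')
open B7Prop2SpecialUnitary (specialUnitaryUnits specialUnitaryUnits_le_unitaryUnits)
open B8Thm2TorusAt (Thm2TorusAt)
open B8Thm2SetupTorus (Thm2SetupSUAt thm2SetupSUAt_of_thm2TorusAt)
open B8Thm2TorusCoverGCOfProp6 (exists_admissible_sizes_below)
open T3ContinuumYM3Torus (T3Family)
open T3SectALandauChart (eta eta_pos)
open T3B8Thm2AtMembers (B8Thm2AtT3Members)
open Summit.QuantumFields.YangMills.BalabanUVNodes.N16.Thm2TorusOfCover (thm2TorusAt_of_dvd')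
open Summit.QuantumFields.YangMills.Theorems.Prop7Thm2SocketOfCoverForm (abs_re_trace_star_mul_le trace_mul_comm_two)
open Summit.QuantumFields.YangMills.Theorems.MinimiserStabilityRegPrOfB8Thm2AtT3Members (b8Thm2AtT3Members_of_hThm2S3)

/-! ## §1 ★ The socket's descent at an ARBITRARY block-size index `ℓ`: cover-form text at `ℓ` ⟹ socket body at `L = ℓ + 1` -/

/-- ★ **THE SOCKET DESCENT CARRIES NO FLOOR ON THE BLOCK SIZE.**  For any `ℓ` with `ℓ + 1` odd and `> 1` (so `ℓ ≥ 2`): IF lit-balaban's torus cover form of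
[Balaban1985RegularSpaces] Thm 2 holds at the index `ℓ` — hypothesis `hCover`, the TYPE of ✓`B8Thm2TorusCoverOfProp6DeltaA.hThm2Cover_of_prop6_deltaA hℓ` verbatim
(binder telescope `τ hτ hτt hCτ hM1 hαE0 hα1 len`, then `∃ δ_E > 0, ∃ d′ A₀, ∀ a′ ≥ A₀, … ∃ B₁ B₂ c₁ > 0, ∀ F n K, n < K → P ∣ P′ ∧ L^{K−n} ∣ P ∧
Thm2TorusAt (ℓ+1) (K−n) P′ (eta F n K) 0 B₁ B₂ c₁ len SU(2) ⊤`) — THEN the EX display's socket body holds at `L = ℓ + 1` with uniform `B₁, c₁`: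
`∃ B₁ c₁ > 0, ∀ F, F.L = ℓ + 1 → ∀ n < K, ∃ β₀ B₂ len, Thm2SetupSUAt (F.P K) 2 (K − n) (eta F n K) β₀ B₁ B₂ c₁ len ⊤`.  PROOF = p782708's
`thm2SetupSUAt_allMembers_of_coverForm` with the cover form abstracted: `τ := tr` (`C_τ = 2`, ✓`abs_re_trace_star_mul_le`), `M := 1`, `α := 1∕2`, `len := 0`,
windows by ✓`exists_admissible_sizes_below` (floor `1 ≤ L`), three `min`s, descent `P′ → P` by ✓`thm2TorusAt_of_dvd'` (floor `1 ≤ L`, window constant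
`min c₁ (16B₁)⁻¹`), ✓`thm2SetupSUAt_of_thm2TorusAt`, `β₀ := 0`.  CONDITIONAL on `hCover`; at `ℓ = 2` nothing in the tree supplies it.
[cite: Balaban1985RegularSpaces, Thm 2 p.83, (1.33)–(1.39) pp.82–83, p.77; Balaban1985BackgroundPropagators, Thm 3.3 p.399, Thm 3.10 pp.414–416; Balaban1985UV3, (1)–(3) p.256] -/
theorem thm2SetupSUAt_allMembers_of_coverFormAt {ℓ : ℕ} (hL : Odd (ℓ + 1) ∧ 1 < ℓ + 1) (hd₃ : 1 ≤ 2 + 1)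
    (hCover : ∀ (τ : (Matrix (Fin 2) (Fin 2) ℂ) →ₗ[ℂ] ℂ) (_hτ : ∀ a, τ a = Matrix.trace a) (_hτt : ∀ a b, τ (a * b) = τ (b * a))
      {Cτ : ℝ} (_hCτ : ∀ x y : (Matrix (Fin 2) (Fin 2) ℂ), |(τ (star x * y)).re| ≤ Cτ * ‖x‖ * ‖y‖)
      {M : ℝ} (_hM1 : 1 ≤ M) {α : ℝ} (_hαE0 : 0 < α) (_hα1 : α < 1) {len : LSite (2 + 1) → ℝ},
      letI : CStarAlgebra (Matrix (Fin 2) (Fin 2) ℂ) := {}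
      ∃ δE : ℝ, 0 < δE ∧ ∃ d' A₀ : ℕ, ∀ a' : ℕ, A₀ ≤ a' → ∃ cP : ℝ, 0 < cP ∧ ∃ BE : ℝ, 0 < BE ∧ ∃ aJ : ℝ, 0 < aJ ∧
      ∀ aT : ℝ, 0 < aT → aT ≤ alphaQ (2 + 1) (ℓ + 1) / ((ℓ + 1 : ℕ) : ℝ) ^ 2 → C0 (2 + 1) * aT ≤ 1 / 3 → 2 * aT ≤ c2' (2 + 1) (ℓ + 1) →
        2 * ((48 * (((2 : ℕ) : ℝ) + 1) + 14 * ((2 : ℕ) : ℝ) * M + (32 * (((2 : ℕ) : ℝ) + 2) ^ 2 +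
          12 * (((2 : ℕ) : ℝ) + 1) ^ 2 * (13344 * (((2 : ℕ) : ℝ) + 1) * (((2 : ℕ) : ℝ) + 2) ^ 2 * (((2 : ℕ) : ℝ) + 5) * (((ℓ + 1 : ℕ) : ℝ)) ^ (2 + 4)) *
            (Cτ * betaTau τ))) * aT) * (2 * (BE * B6.c1 d' δE (1 - α) * (((ℓ + 1 : ℕ) : ℝ)) ^ 4)) ≤ 1 →
        aT ≤ cP →
      ∀ α₀' : ℝ, 0 < α₀' → α₀' ≤ aJ → C0 (2 + 1) * α₀' ≤ 1 / 3 → 2 * α₀' ≤ c2' (2 + 1) (ℓ + 1) → aT * (((ℓ + 1 : ℕ) : ℝ)) ^ (2 * 1) < α₀' →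
      ∃ a₀' : ℝ, 0 < a₀' ∧ ∃ k₀ : ℕ, ∃ cα : ℝ, 0 < cα ∧
      ∀ cL : ℝ, 0 < cL → cL * (((ℓ + 1 : ℕ) : ℝ)) ^ 2 < a₀' →
        cL ≤ min (1 / 16) (min aT (min aT (1 / (2 * (2 * (2 * (BE * B6.c1 d' δE (1 - α) * (((ℓ + 1 : ℕ) : ℝ)) ^ 4))) *
          (14 * ((2 + 1 - 1 : ℕ) : ℝ)) * M + 1)))) →
        cL ≤ cα →
      ∃ B₁' B₂ c₁ : ℝ, 0 < B₁' ∧ 0 < B₂ ∧ 0 < c₁ ∧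
      ∀ F : T3Family, F.L = ℓ + 1 → ∀ (n K : ℕ), n < K →
        (((F.P K).sitesPerDir 0 : ℕ) : ℤ) ∣ (((PV 2 ℓ (F.m + k₀) K hd₃ hL).sitesPerDir 0 : ℕ) : ℤ) ∧
        (((ℓ + 1 : ℕ) : ℤ)) ^ (K - n) ∣ (((F.P K).sitesPerDir 0 : ℕ) : ℤ) ∧
        Thm2TorusAt (ℓ + 1) (K - n) ((((PV 2 ℓ (F.m + k₀) K hd₃ hL).sitesPerDir 0 : ℕ) : ℤ)) (eta F n K) 0 B₁' B₂ c₁ len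
          (specialUnitaryUnits (Fin 2)) (fun _ => True)) :
    ∃ B₁ c₁ : ℝ, 0 < B₁ ∧ 0 < c₁ ∧ ∀ (F : T3Family), F.L = ℓ + 1 → ∀ (n K : ℕ), n < K →
      ∃ (β₀ B₂ : ℝ) (len : LSite (F.P K).d → ℝ),
        Thm2SetupSUAt (F.P K) 2 (K - n) (eta F n K) β₀ B₁ B₂ c₁ len (fun _ => True) := by
  letI : CStarAlgebra (Matrix (Fin 2) (Fin 2) ℂ) := {}
  -- the cover form at `τ := tr`, `C_τ := 2`, `M := 1`, `α := 1/2`, `len := 0`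
  obtain ⟨δE, hδE, d', A₀, H1⟩ := hCover (len := fun _ => (0 : ℝ))
    (Matrix.traceLinearMap (Fin 2) ℂ ℂ) (fun a => Matrix.traceLinearMap_apply _ _ _ a) trace_mul_comm_two
    (Cτ := 2) abs_re_trace_star_mul_le (M := 1) le_rfl (α := 1 / 2) (by norm_num) (by norm_num)
  obtain ⟨cP, hcP, BE, hBE, aJ, haJ, H2⟩ := H1 A₀ le_rfl
  -- the `a_T` ∕ `α₀′` windows (floor `1 ≤ L` only)
  obtain ⟨α₀', aT, haT, h1, h2, h3, h4, h5, hα₀', h6, h7, h8, h9⟩ :=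
    exists_admissible_sizes_below (2 + 1) (L := ℓ + 1) (by omega)
      (48 * (((2 : ℕ) : ℝ) + 1) + 14 * ((2 : ℕ) : ℝ) * (1 : ℝ) + (32 * (((2 : ℕ) : ℝ) + 2) ^ 2 +
        12 * (((2 : ℕ) : ℝ) + 1) ^ 2 * (13344 * (((2 : ℕ) : ℝ) + 1) * (((2 : ℕ) : ℝ) + 2) ^ 2 * (((2 : ℕ) : ℝ) + 5) * (((ℓ + 1 : ℕ) : ℝ)) ^ (2 + 4)) *
          ((2 : ℝ) * betaTau (Matrix.traceLinearMap (Fin 2) ℂ ℂ))))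
      (2 * (BE * B6.c1 d' δE (1 - 1 / 2) * (((ℓ + 1 : ℕ) : ℝ)) ^ 4)) haJ hcP
  obtain ⟨a₀', ha₀', k₀, cα, hcα, H3⟩ := H2 aT haT h1 h2 h3 h4 h5 α₀' hα₀' h6 h7 h8 h9
  -- the `c_L` windows
  have hLpos : (0 : ℝ) < ((ℓ + 1 : ℕ) : ℝ) := by positivity
  have hL2 : (0 : ℝ) < (((ℓ + 1 : ℕ) : ℝ)) ^ 2 := by positivity
  have hden : (0 : ℝ) < 2 * (2 * (2 * (BE * B6.c1 d' δE (1 - 1 / 2) * (((ℓ + 1 : ℕ) : ℝ)) ^ 4))) * (14 * ((2 + 1 - 1 : ℕ) : ℝ)) * (1 : ℝ) + 1 := by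
    have hc1 : 0 ≤ B6.c1 d' δE (1 - 1 / 2) := B6RandomWalk.c1_nonneg d' δE _
    positivity
  set W : ℝ := min (1 / 16) (min aT (min aT (1 / (2 * (2 * (2 * (BE * B6.c1 d' δE (1 - 1 / 2) * (((ℓ + 1 : ℕ) : ℝ)) ^ 4))) *
    (14 * ((2 + 1 - 1 : ℕ) : ℝ)) * (1 : ℝ) + 1)))) with hW
  have hWpos : 0 < W := by
    rw [hW]; exact lt_min (by norm_num) (lt_min haT (lt_min haT (one_div_pos.mpr hden)))
  set cL : ℝ := min (a₀' / (2 * (((ℓ + 1 : ℕ) : ℝ)) ^ 2)) (min W cα) with hcL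
  have hcL0 : 0 < cL := by rw [hcL]; exact lt_min (by positivity) (lt_min hWpos hcα)
  have hcL1 : cL * (((ℓ + 1 : ℕ) : ℝ)) ^ 2 < a₀' := by
    have : cL ≤ a₀' / (2 * (((ℓ + 1 : ℕ) : ℝ)) ^ 2) := by rw [hcL]; exact min_le_left _ _
    calc cL * (((ℓ + 1 : ℕ) : ℝ)) ^ 2 ≤ a₀' / (2 * (((ℓ + 1 : ℕ) : ℝ)) ^ 2) * (((ℓ + 1 : ℕ) : ℝ)) ^ 2 :=
          mul_le_mul_of_nonneg_right this hL2.le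
      _ = a₀' / 2 := by field_simp
      _ < a₀' := by linarith
  have hcL2 : cL ≤ W := by rw [hcL]; exact (min_le_right _ _).trans (min_le_left _ _)
  have hcL3 : cL ≤ cα := by rw [hcL]; exact (min_le_right _ _).trans (min_le_right _ _)
  obtain ⟨B₁', B₂, c₁, hB₁', hB₂, hc₁, H4⟩ := H3 cL hcL0 hcL1 (by rw [hW] at hcL2; exact hcL2) hcL3
  refine ⟨B₁', min c₁ (16 * B₁')⁻¹, hB₁', lt_min hc₁ (by positivity), fun F hF n K hnK => ?_⟩
  obtain ⟨hdvd, hpow, hT⟩ := H4 F hF n K hnK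
  -- descend from the cover period to the member's own period (uniqueness half), then to the Setup currency
  obtain ⟨L', hL', m, hm⟩ := F
  subst hF
  haveI : Nonempty (Fin 2) := ⟨0⟩
  have hT' := thm2TorusAt_of_dvd' (n := Fin 2) (L := ℓ + 1) (by omega) hdvd hpow (eta_pos _ n K) hB₁'
    specialUnitaryUnits_le_unitaryUnits hT
  exact ⟨0, B₂, fun _ => (0 : ℝ), thm2SetupSUAt_of_thm2TorusAt hT'⟩

/-! ## §2 ★★ At `ℓ = 2`: the named fact from the cover-form text alone -/

/-- ★★ **`B8Thm2AtT3Members` ⟸ lit-balaban's TORUS COVER FORM OF [Balaban1985RegularSpaces] THM 2 AT THE INDEX `ℓ = 2` (block size `L = 3`), NOTHING ELSE.**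
The hypothesis is the TYPE of `B8Thm2TorusCoverOfProp6DeltaA.hThm2Cover_of_prop6_deltaA` with `4 ≤ ℓ` replaced by `ℓ = 2` (at `hL₃ : Odd 3 ∧ 1 < 3`,
`hd₃ : 1 ≤ 3`); the conclusion is the Literature named fact ✓`T3B8Thm2AtMembers.B8Thm2AtT3Members` (p793328), reached through §1 at `ℓ = 2` and
✓`MinimiserStabilityRegPrOfB8Thm2AtT3Members.b8Thm2AtT3Members_of_hThm2S3` (every `L ≥ 5` is a theorem, `L ∈ {2, 4}` vacuous).  This is the END POINT the
`ℓ = 2` re-edition of lit-balaban's cover chain has to reach (port plan `PORT-PLAN-B8Thm2-v1.md`); CONDITIONAL — nothing in the tree supplies the hypothesis.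
[cite: Balaban1985RegularSpaces, Thm 2 p.83, (1.33)–(1.39) pp.82–83, Prop. 6 p.99, p.77; Balaban1985BackgroundPropagators, Thm 3.3 p.399, Cor. 3.6 p.408; Balaban1985UV3, (1)–(3) p.256] -/
theorem b8Thm2AtT3Members_of_coverForm_two (hL₃ : Odd (2 + 1) ∧ 1 < 2 + 1) (hd₃ : 1 ≤ 2 + 1)
    (hCover₂ : ∀ (τ : (Matrix (Fin 2) (Fin 2) ℂ) →ₗ[ℂ] ℂ) (_hτ : ∀ a, τ a = Matrix.trace a) (_hτt : ∀ a b, τ (a * b) = τ (b * a))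
      {Cτ : ℝ} (_hCτ : ∀ x y : (Matrix (Fin 2) (Fin 2) ℂ), |(τ (star x * y)).re| ≤ Cτ * ‖x‖ * ‖y‖)
      {M : ℝ} (_hM1 : 1 ≤ M) {α : ℝ} (_hαE0 : 0 < α) (_hα1 : α < 1) {len : LSite (2 + 1) → ℝ},
      letI : CStarAlgebra (Matrix (Fin 2) (Fin 2) ℂ) := {}
      ∃ δE : ℝ, 0 < δE ∧ ∃ d' A₀ : ℕ, ∀ a' : ℕ, A₀ ≤ a' → ∃ cP : ℝ, 0 < cP ∧ ∃ BE : ℝ, 0 < BE ∧ ∃ aJ : ℝ, 0 < aJ ∧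
      ∀ aT : ℝ, 0 < aT → aT ≤ alphaQ (2 + 1) (2 + 1) / ((2 + 1 : ℕ) : ℝ) ^ 2 → C0 (2 + 1) * aT ≤ 1 / 3 → 2 * aT ≤ c2' (2 + 1) (2 + 1) →
        2 * ((48 * (((2 : ℕ) : ℝ) + 1) + 14 * ((2 : ℕ) : ℝ) * M + (32 * (((2 : ℕ) : ℝ) + 2) ^ 2 +
          12 * (((2 : ℕ) : ℝ) + 1) ^ 2 * (13344 * (((2 : ℕ) : ℝ) + 1) * (((2 : ℕ) : ℝ) + 2) ^ 2 * (((2 : ℕ) : ℝ) + 5) * (((2 + 1 : ℕ) : ℝ)) ^ (2 + 4)) *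
            (Cτ * betaTau τ))) * aT) * (2 * (BE * B6.c1 d' δE (1 - α) * (((2 + 1 : ℕ) : ℝ)) ^ 4)) ≤ 1 →
        aT ≤ cP →
      ∀ α₀' : ℝ, 0 < α₀' → α₀' ≤ aJ → C0 (2 + 1) * α₀' ≤ 1 / 3 → 2 * α₀' ≤ c2' (2 + 1) (2 + 1) → aT * (((2 + 1 : ℕ) : ℝ)) ^ (2 * 1) < α₀' →
      ∃ a₀' : ℝ, 0 < a₀' ∧ ∃ k₀ : ℕ, ∃ cα : ℝ, 0 < cα ∧
      ∀ cL : ℝ, 0 < cL → cL * (((2 + 1 : ℕ) : ℝ)) ^ 2 < a₀' →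
        cL ≤ min (1 / 16) (min aT (min aT (1 / (2 * (2 * (2 * (BE * B6.c1 d' δE (1 - α) * (((2 + 1 : ℕ) : ℝ)) ^ 4))) *
          (14 * ((2 + 1 - 1 : ℕ) : ℝ)) * M + 1)))) →
        cL ≤ cα →
      ∃ B₁' B₂ c₁ : ℝ, 0 < B₁' ∧ 0 < B₂ ∧ 0 < c₁ ∧
      ∀ F : T3Family, F.L = 2 + 1 → ∀ (n K : ℕ), n < K →
        (((F.P K).sitesPerDir 0 : ℕ) : ℤ) ∣ (((PV 2 2 (F.m + k₀) K hd₃ hL₃).sitesPerDir 0 : ℕ) : ℤ) ∧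
        (((2 + 1 : ℕ) : ℤ)) ^ (K - n) ∣ (((F.P K).sitesPerDir 0 : ℕ) : ℤ) ∧
        Thm2TorusAt (2 + 1) (K - n) ((((PV 2 2 (F.m + k₀) K hd₃ hL₃).sitesPerDir 0 : ℕ) : ℤ)) (eta F n K) 0 B₁' B₂ c₁ len
          (specialUnitaryUnits (Fin 2)) (fun _ => True)) :
    B8Thm2AtT3Members :=
  b8Thm2AtT3Members_of_hThm2S3 (thm2SetupSUAt_allMembers_of_coverFormAt (ℓ := 2) hL₃ hd₃ hCover₂)

end Summit.QuantumFields.YangMills.Theorems.B8Thm2AtT3MembersOfCoverFormTwo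

end
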